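import Literature.AlgebraicGeometry.Motives.ProjBaseChangeAny
import Literature.AlgebraicGeometry.Motives.ProjectiveSpaceFunctionField
import Mathlib.AlgebraicGeometry.Geometrically.Integral
import HarnessLib

/-!
# `ℙᴺ_k → Spec k` is geometrically integral; `ℙᴺ ×ₖ B` is integral for `B` integral

Liu, *Algebraic Geometry and Arithmetic Curves*, Prop. 3.1.9 / Ex. 3.1.10: `ℙᴺ_k ×_k K = ℙᴺ_K` for
every field extension `K/k` (the tree's `ProjBaseChangeRing.isPullback_projMap'`), and `ℙᴺ_K` is
integral (`Motives/VarietiesProjectiveSpaceProofs`); hence the structure morphism `ℙᴺ_k → Spec k`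
is geometrically integral in Mathlib's sense (`GeometricallyIntegral`: every base change to a
field is integral), and by Mathlib (`GeometricallyIntegral` + flat + universally open ⇒ products
with integral locally Noetherian schemes are integral; Görtz–Wedhorn I, Prop. 5.51 (ii)) the
product `ℙᴺ ×ₖ B` with an integral `k`-scheme `B` locally of finite type is integral — the
integrality of the total space of the families of subvarieties of `ℙᴺ` parametrised by `B` used
by the tree's cycle calculus on `ℙᴺ ×ₖ B` (`Motives/RuledSurfaceRelation`, `Motives/PlaneFamilyRelation`).

* `geometricallyIntegral_projectiveSpace_hom` (instance);
* `isIntegral_projectiveSpace_tensor_left` (instance): `IsIntegral ((projectiveSpace N k) ⊗ B).left`.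

Everything is proved; no named facts.

## References

* [Liu2002] Q. Liu, Algebraic Geometry and Arithmetic Curves (2002), Prop. 3.1.9, Ex. 3.1.10.
* [GortzWedhorn2020] U. Görtz, T. Wedhorn, Algebraic Geometry I, 2nd ed. (2020), Prop. 5.51.
-/

noncomputable section

open CategoryTheory CategoryTheory.Limits AlgebraicGeometry MonoidalCategory

universe u

namespace Literature.AlgebraicGeometry.Motives

attribute [local instance] MvPolynomial.gradedAlgebra

open ProjBaseChangeRing

variable (N : ℕ) (k : Type u) [Field k]

/-- **`ℙᴺ_k → Spec k` is geometrically integral**: its base change along any `Spec K → Spec k`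
(`K` a field) is `ℙᴺ_K` (Liu, Prop. 3.1.9), which is integral. [cite: Liu2002, Prop. 3.1.9 and Ex. 3.1.10] -/
instance geometricallyIntegral_projectiveSpace_hom :
    GeometricallyIntegral (projectiveSpace N k).hom := by
  refine ⟨fun K _ y Z fst snd h => ?_⟩
  obtain ⟨φ, rfl⟩ := Spec.map_surjective y
  letI : Algebra k K := φ.hom.toAlgebra
  have hproj : IsPullback
      (Proj.map (mapGraded k K (Fin (N + 1))) (irrelevant_le_map k K (Fin (N + 1))))
      (projToSpec (Fin (N + 1)) K) (projectiveSpace N k).hom (Spec.map φ) :=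
    isPullback_projMap' k K (n := N)
  haveI : IsIntegral (Proj (MvPolynomial.homogeneousSubmodule (Fin (N + 1)) K)) :=
    inferInstanceAs (IsIntegral (ProjSpace.P N K))
  exact IsIntegral.of_isIso (hproj.isoIsPullback _ _ h).hom

/-- **`ℙᴺ ×ₖ B` is integral** for an integral `k`-scheme `B` locally of finite type (Görtz–Wedhorn I,
Prop. 5.51 (ii): products of a geometrically integral scheme with integral schemes are integral;
Mathlib's instance for geometrically integral, flat, universally open morphisms).
[cite: GortzWedhorn2020, Prop. 5.51] -/
instance isIntegral_projectiveSpace_tensor_left (B : SchemeOver k) [IsIntegral B.left]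
    [LocallyOfFiniteType B.hom] : IsIntegral ((projectiveSpace N k) ⊗ B).left := by
  haveI : IsLocallyNoetherian B.left := LocallyOfFiniteType.isLocallyNoetherian B.hom
  exact inferInstanceAs (IsIntegral (pullback (projectiveSpace N k).hom B.hom))

end Literature.AlgebraicGeometry.Motives

end
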